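import Summits.BirchSwinnertonDyer.Rank1Residual.Additive.GordDescentThree
import Literature.NumberTheory.EllipticCurves.Wuthrich2014.ThreeAdicImageSupersingularProofs
import HarnessLib

/-!
# `GordDescentThree` WITHOUT the binder `hL20` (Wuthrich's Lemma 20 is a tree theorem): binder-free twins

HONEST FRAMING (cell `b2b-bsdres`, run/shared/lean/b2b/bsd-rank1-residual/, verbatim in every
file): the goal of the cell is to DELETE the COMBINATION-SHAPED residual classes of the
Birch–Swinnerton-Dyer formula for ALL analytic-rank `≤ 1` elliptic curves over `ℚ` — "full BSD
formula for every rank `≤ 1` curve in class `C`" assembled STRICTLY from published theorems — so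
that the rank-`≤ 1` remainder becomes exactly the CONSTRUCTION-SHAPED classes, which are TYPED
(missing-input `Prop`s), NOT attempted. This is not "finishing BSD". Team n1011 (N10 / N11), seat
p05, OWNERS row T-b1ss = the `hL20`-BINDER SWEEP on `Additive/` + `AdditivePotMult/`: Wuthrich's
Lemma 20 (registry A9, the named fact `Wuthrich2014.lemma20_surjective_threeAdic_of_semistable`: at a
prime-to-`9` conductor, `ρ̄_{E,3}` onto ⟹ `ρ̄_{E,3ⁿ}` onto for all `n`) is a tree THEOREM since
2026-08-21 (`Wuthrich2014.lemma20_surjective_threeAdic_of_semistable_holds`, file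
`Literature/NumberTheory/EllipticCurves/Wuthrich2014/ThreeAdicImageSupersingularProofs.lean`, units
lit-kato / n1011-p02), so every theorem of the cell carrying it as a hypothesis has a twin WITHOUT that
binder.  This file states those twins for the theorems of its sibling (suffix `_noL20`; statement =
the sibling's statement with the binder deleted, other hypotheses unchanged; proof = the sibling's
theorem fed with `_holds`).  No claim beyond the stated classes; labels UNCHANGED; nothing is booked.
Theorems only (no definition, no named fact minted).

## What this file proves

Binder-free twins (`_noL20`) of the 4 theorems of `Summits/BirchSwinnertonDyer/Rank1Residual/Additive/GordDescentThree.lean` that carry the hypothesis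
`(hL20 : Wuthrich2014.lemma20_surjective_threeAdic_of_semistable)`:
* `bsdp_three_of_classX4Gord_of_surj_of_forall_ramified'_noL20`
* `bsdp_iff_overC_three_of_classX4Gord_of_surj'_noL20`
* `bsdp_three_of_classX3Gord_cases_noL20`
* `ClassX4Gord.exists_quadraticField_goodOrd_bsdp_iff_three_noL20`

References: [Wuthrich2014] C. Wuthrich, Doc. Math. 19 (2014) 381–402, Lemma 20 (p. 399); the
sibling's references for everything else.
-/

noncomputable section

open scoped Classical NumberField

open WeierstrassCurve IsDedekindDomain NumberField Literature.NumberTheory.EllipticCurves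
  Literature.NumberTheory.EllipticCurves.Rank1Residual
  Literature.NumberTheory.EllipticCurves.Rank1Residual.Typed
  Literature.NumberTheory.EllipticCurves.ModularForms
  Literature.NumberTheory.EllipticCurves.Wuthrich2014
  Summit.BirchSwinnertonDyer.Rank1Residual.AdditivePotMult

namespace Summit.BirchSwinnertonDyer.Rank1Residual.Additive

variable (W : WeierstrassCurve ℚ) [W.IsElliptic] [W.IsGloballyMinimal]

/-- **Binder-free twin of `bsdp_three_of_classX4Gord_of_surj_of_forall_ramified'`** — the same statement WITHOUT the hypothesis
`Wuthrich2014.lemma20_surjective_threeAdic_of_semistable` (Wuthrich 2014 Lemma 20 = registry A9, now the tree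
theorem `…_holds`); proof = the original fed with `_holds`. [cite: Wuthrich2014, Lemma 20 (p. 399)] -/
theorem bsdp_three_of_classX4Gord_of_surj_of_forall_ramified'_noL20
    (hYZ : YanZhu2026.thm415_padicValRat_bsd_rank_le_one) (hmod : hasEntireLFunction_rat)
    (hGZK : rank_eq_analyticRank_of_analyticRank_le_one)
    (hMilneC : Milne1972.bsdQuotient_baseChange_quadratic_anyModel)
    (hHL : HoffsteinLuo1997_exists_twist_L_one_ne_zero) (hX : ClassX4Gord W 3) (hsurj : Surj W 3)
    (hr : W.analyticRank ≤ 1)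
    (hK : ∀ (K : Type) [Field K] [NumberField K], Module.finrank ℚ K = 2 →
      (3 : ℤ) ∣ NumberField.discr K → MissingPPartOverCAt (W.baseChange K) 3) :
    BSDp W 3 :=
  bsdp_three_of_classX4Gord_of_surj_of_forall_ramified' W hYZ
    Wuthrich2014.lemma20_surjective_threeAdic_of_semistable_holds hmod hGZK hMilneC hHL hX hsurj hr
    hK

/-- **Binder-free twin of `bsdp_iff_overC_three_of_classX4Gord_of_surj'`** — the same statement WITHOUT the hypothesis
`Wuthrich2014.lemma20_surjective_threeAdic_of_semistable` (Wuthrich 2014 Lemma 20 = registry A9, now the tree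
theorem `…_holds`); proof = the original fed with `_holds`. [cite: Wuthrich2014, Lemma 20 (p. 399)] -/
theorem bsdp_iff_overC_three_of_classX4Gord_of_surj'_noL20
    (hYZ : YanZhu2026.thm415_padicValRat_bsd_rank_le_one)
    (hGZK : rank_eq_analyticRank_of_analyticRank_le_one) (hmod : hasEntireLFunction_rat)
    (hMilneC : Milne1972.bsdQuotient_baseChange_quadratic_anyModel) (hX : ClassX4Gord W 3)
    (hsurj : Surj W 3) (hr : W.analyticRank ≤ 1)
    (hrd : (W.quadraticTwist ((-1 : ℚ) ^ ((3 : ℕ) / 2) * (3 : ℕ))).analyticRank ≤ 1) (K : Type)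
    [Field K] [NumberField K] (h2 : Module.finrank ℚ K = 2)
    (hdK : (NumberField.discr K : ℚ) = (-1 : ℚ) ^ ((3 : ℕ) / 2) * (3 : ℕ)) :
    BSDp W 3 ↔ MissingPPartOverCAt (W.baseChange K) 3 :=
  bsdp_iff_overC_three_of_classX4Gord_of_surj' W hYZ
    Wuthrich2014.lemma20_surjective_threeAdic_of_semistable_holds hGZK hmod hMilneC hX hsurj hr hrd
    K h2 hdK

/-- **Binder-free twin of `bsdp_three_of_classX3Gord_cases`** — the same statement WITHOUT the hypothesis
`Wuthrich2014.lemma20_surjective_threeAdic_of_semistable` (Wuthrich 2014 Lemma 20 = registry A9, now the tree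
theorem `…_holds`); proof = the original fed with `_holds`. [cite: Wuthrich2014, Lemma 20 (p. 399)] -/
theorem bsdp_three_of_classX3Gord_cases_noL20
    (hSk : Skinner2016.thmC_padicValRat_bsd_rank_zero)
    (hBCS : BurungaleCastellaSkinner2025.cor131_padicValRat_bsd_rank_le_one)
    (hJSW : JetchevSkinnerWan2017.thm121_padicValRat_bsd_rank_one)
    (hCGS : CastellaGrossiSkinner2025.thmD_padicValRat_bsd_rank_le_one)
    (hGV : GreenbergVatsal2000.thm13_charIdeal_eq_of_gvPar) (hGr : greenberg_charValue_rankZero)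
    (hmod : hasEntireLFunction_rat) (hmodP : nonempty_modularParametrizationData)
    (hGZK : rank_eq_analyticRank_of_analyticRank_le_one) (hCM : bsdTriple_of_hasCM_of_L_one_ne_zero)
    (hKob : Kobayashi2013.cor14_bsdp_of_cm_rank_one)
    (hYZ : YanZhu2026.thm415_padicValRat_bsd_rank_le_one)
    (hLLT : LiLiuTian2024.thm11_bsdp_of_cm_rank_one) (hW' : sha_dvd_analyticSha)
    (hMilneC : Milne1972.bsdQuotient_baseChange_quadratic_anyModel) (hX : ClassX3Gord W 3)
    (hr : W.analyticRank ≤ 1)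
    (hrd : (W.quadraticTwist ((-1 : ℚ) ^ ((3 : ℕ) / 2) * (3 : ℕ))).analyticRank ≤ 1)
    (hK : ∀ (K : Type) [Field K] [NumberField K], Module.finrank ℚ K = 2 →
      (NumberField.discr K : ℚ) = (-1 : ℚ) ^ ((3 : ℕ) / 2) * (3 : ℕ) →
        MissingPPartOverCAt (W.baseChange K) 3)
    (hX1 : ∀ (Wd : WeierstrassCurve ℚ) [Wd.IsElliptic] [Wd.IsGloballyMinimal],
      (∃ C : VariableChange ℚ, C • W.quadraticTwist ((-1 : ℚ) ^ ((3 : ℕ) / 2) * (3 : ℕ)) = Wd) →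
      ClassX1 Wd 3 → X1.MissingInputAt Wd 3) :
    BSDp W 3 :=
  bsdp_three_of_classX3Gord_cases W hSk hBCS hJSW hCGS hGV hGr hmod hmodP hGZK hCM hKob hYZ
    Wuthrich2014.lemma20_surjective_threeAdic_of_semistable_holds hLLT hW' hMilneC hX hr hrd hK hX1

/-- **Binder-free twin of `ClassX4Gord.exists_quadraticField_goodOrd_bsdp_iff_three`** — the same statement WITHOUT the hypothesis
`Wuthrich2014.lemma20_surjective_threeAdic_of_semistable` (Wuthrich 2014 Lemma 20 = registry A9, now the tree
theorem `…_holds`); proof = the original fed with `_holds`. [cite: Wuthrich2014, Lemma 20 (p. 399)] -/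
theorem ClassX4Gord.exists_quadraticField_goodOrd_bsdp_iff_three_noL20
    (hYZ : YanZhu2026.thm415_padicValRat_bsd_rank_le_one) (hmod : hasEntireLFunction_rat)
    (hGZK : rank_eq_analyticRank_of_analyticRank_le_one)
    (hMilneC : Milne1972.bsdQuotient_baseChange_quadratic_anyModel)
    (hHL : HoffsteinLuo1997_exists_twist_L_one_ne_zero) (hX : ClassX4Gord W 3) (hsurj : Surj W 3)
    (hr : W.analyticRank ≤ 1) :
    ∃ (K : Type) (_ : Field K) (_ : NumberField K), Module.finrank ℚ K = 2 ∧
      (3 : ℤ) ∣ NumberField.discr K ∧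
      (∀ w : HeightOneSpectrum (𝓞 K), ((3 : ℕ) : 𝓞 K) ∈ w.asIdeal →
        (W.baseChange K).HasGoodReductionAt w ∧ (W.baseChange K).HasUnitRootAt w ∧
          (Ideal.span {((3 : ℕ) : ℤ)}).ramificationIdx' w.asIdeal = 2) ∧
      (BSDp W 3 ↔ MissingPPartOverCAt (W.baseChange K) 3) :=
  ClassX4Gord.exists_quadraticField_goodOrd_bsdp_iff_three W hYZ
    Wuthrich2014.lemma20_surjective_threeAdic_of_semistable_holds hmod hGZK hMilneC hHL hX hsurj hr

end Summit.BirchSwinnertonDyer.Rank1Residual.Additive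

end
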